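import Summits.HubbardSuperconductivity.HubbardSuperconductivity.Theorems.WidthHaldaneDefs
import Summits.HubbardSuperconductivity.HubbardSuperconductivity.Theorems.SeamInductionPerWidthThermodynamicsStiffnessOfFloorOfTransparency

/-!
# Line `Ideator1Sketch` for the crux `PerWidthThermodynamics` (stmt-HubbardSuperconductivity-18510),
# route `SeamInduction` — skeleton (lead prover's work file; sorries ONLY in `stub_*`)

Composition (two-cut transparency ⊕ canonical-flux floor ⊕ pair-compressibility window), at the
COMMITTED WITNESS `(U, δ) = (6, (3 - √5)/4)` (irrational doping: no finitely periodic charge-gapped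
ground state is LSM-allowed at any width; `U = 6` below the filled-stripe regime):

* `stub_transparency` (★ physics; Seidel–Lee flux-period halving `hc/2e` from the odd-charge gap):
  for every even width `M ≥ 2` and every `η > 0`, eventually in even `L`,
  `|E_{L,M}(π, N) - E_{L,M}(0, N)| ≤ η M / L`.
* `stub_canonicalFluxFloor` (★ physics; parity-CLASS-FREE Byers–Yang floor, quantitative Lieb–Loss /
  Lieb–Nachtergaele shape): for every even `M ≥ 2` there are `c_M > 0`, `L₁` with
  `c_M M / L ≤ E(π/3, N) - min (E(0,N), E(π,N))` for all even `L ≥ max(M, L₁)`.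
* `stub_pairCompressibility` (★ physics; no charge gap, no phase separation): for every even `M ≥ 2`
  there are `k_M`, `L₁` with `0 < ẽ″_{L,M} ≤ k_M` eventually.
* `stub_stiffness_of_floor_of_transparency` (glue, elementary real arithmetic, pointwise in all data):
  floor `c M/L` and half-transparency `|E(π) - E(0)| ≤ (c/2) M/L` give `9c/π² ≤ ρ̃_{L,M}` —
  LANDED (p146920, `…Theorems.PerWidthThermodynamics.stub_stiffness_of_floor_of_transparency`).
* `PerWidthThermodynamics_of` — PROVED composition concluding the crux BY NAME
  (`perWidthThermodynamics_iff` of `WidthHaldaneDefs` unfolds the `let`-prefix).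

Everything is eventual in `L` (honours `Disproof.perWidthThermodynamics_false_without_L₁`: at `L = 2`
the seam twist is a pure gauge) and stated at `U = 6 > 0` only (honours the `U = 0` near-miss
`Disproof.perWidthThermodynamics_false_at_U_zero`: free tubes violate both conclusions cofinally).
No new definitions: all statements are over `tubeEnergy` / `tubeFilling` / `tubeStiffness` /
`tubePairCompressibility` (WidthHaldaneDefs).
-/

noncomputable section

namespace Summit.HubbardSuperconductivity.HubbardSuperconductivity.Theorems.SeamInduction

set_option linter.dupNamespace false -- summit = problem name (single-conjunct summit), D-0017

open Matrix Literature.MathematicalPhysics.QuantumLattice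
open Summit.HubbardSuperconductivity.HubbardSuperconductivity.Theorems.WidthHaldane
open Summit.HubbardSuperconductivity.HubbardSuperconductivity.Theses.SeamInduction (PerWidthThermodynamics)

/-! ### The three physics stubs at the witness `(U, δ) = (6, (3 - √5)/4)` -/

/-- **stub 1 — TRANSPARENCY (flux-period halving)** at `(U, δ) = (6, (3-√5)/4)`: for every even width
`M ≥ 2` and every `η > 0` there is `L₂` such that for all even `L ≥ max(M, L₂)` and every labelling,
`|E_{L,M}(π, N_{L,M}) - E_{L,M}(0, N_{L,M})| ≤ η M / L` — the sector-minimum envelope has period `π`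
(`hc/2e`) up to `o(M/L)`; mechanism: additivity of two far-apart column sign-flip defects, fed by the
odd-charge (pair-binding) gap (Seidel–Lee, PRB 71 (2005) 045113, §4). ★ physics. -/
theorem stub_transparency :
    ∀ (M : ℕ) [NeZero M], Even M → 2 ≤ M → ∀ η : ℝ, 0 < η → ∃ L₂ : ℕ, ∀ (L : ℕ) [NeZero L],
      Even L → M ≤ L → L₂ ≤ L → ∀ (Λ : Type) [LinearOrder Λ] [Fintype Λ] (e : Λ ≃ ZMod L × ZMod M),
        |tubeEnergy L M Λ e 6 Real.pi (tubeFilling L M ((3 - Real.sqrt 5) / 4)) -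
            tubeEnergy L M Λ e 6 0 (tubeFilling L M ((3 - Real.sqrt 5) / 4))| ≤ η * M / L := by
  sorry

/-- **stub 2 — CANONICAL-FLUX FLOOR** at `(U, δ) = (6, (3-√5)/4)`: for every even width `M ≥ 2` there
are `c > 0` and `L₁` such that for all even `L ≥ max(M, L₁)` and every labelling,
`c M / L ≤ E(π/3, N) - min (E(0, N)) (E(π, N))` — the twisted sector minimum at `θ₀ = π/3` lies above
the better of the two canonical fluxes `0, π` by the one-mode Byers–Yang margin; parity-class-free
(quantitative form of Lieb–Loss / Lieb–Nachtergaele's `argmin ∈ {0, π}`). ★ physics. -/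
theorem stub_canonicalFluxFloor :
    ∀ (M : ℕ) [NeZero M], Even M → 2 ≤ M → ∃ c : ℝ, 0 < c ∧ ∃ L₁ : ℕ, ∀ (L : ℕ) [NeZero L],
      Even L → M ≤ L → L₁ ≤ L → ∀ (Λ : Type) [LinearOrder Λ] [Fintype Λ] (e : Λ ≃ ZMod L × ZMod M),
        c * M / L ≤ tubeEnergy L M Λ e 6 (Real.pi / 3) (tubeFilling L M ((3 - Real.sqrt 5) / 4)) -
          min (tubeEnergy L M Λ e 6 0 (tubeFilling L M ((3 - Real.sqrt 5) / 4)))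
            (tubeEnergy L M Λ e 6 Real.pi (tubeFilling L M ((3 - Real.sqrt 5) / 4))) := by
  sorry

/-- **stub 3 — PAIR-COMPRESSIBILITY WINDOW** at `(U, δ) = (6, (3-√5)/4)`: for every even width `M ≥ 2`
there are `k` and `L₁` such that for all even `L ≥ max(M, L₁)` and every labelling,
`0 < ẽ″_{L,M} ≤ k` (strict convexity of `N ↦ E(0, N)` at the filling at scale `1/(LM)`, and no charge
gap). ★ physics. -/
theorem stub_pairCompressibility :
    ∀ (M : ℕ) [NeZero M], Even M → 2 ≤ M → ∃ k : ℝ, ∃ L₁ : ℕ, ∀ (L : ℕ) [NeZero L],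
      Even L → M ≤ L → L₁ ≤ L → ∀ (Λ : Type) [LinearOrder Λ] [Fintype Λ] (e : Λ ≃ ZMod L × ZMod M),
        0 < tubePairCompressibility L M Λ e 6 ((3 - Real.sqrt 5) / 4) ∧
          tubePairCompressibility L M Λ e 6 ((3 - Real.sqrt 5) / 4) ≤ k := by
  sorry

/-! ### The glue (stub 4) — LANDED

`stub_stiffness_of_floor_of_transparency` is CLOSED: landed verbatim as
`Summit.HubbardSuperconductivity.HubbardSuperconductivity.Theorems.PerWidthThermodynamics.stub_stiffness_of_floor_of_transparency`
(Theorems/SeamInductionPerWidthThermodynamicsStiffnessOfFloorOfTransparency.lean, p146920, accepted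
2026-08-17T07:38Z) and imported above; the composition below calls it by its landed name. -/

/-! ### The witness doping is admissible -/

/-- `δ₀ = (3 - √5)/4 ≈ 0.191 ∈ (0, 3/10)` (from `9/5 < √5 < 3`). -/
theorem witnessDoping_mem_Ioo : (3 - Real.sqrt 5) / 4 ∈ Set.Ioo (0 : ℝ) (3 / 10) := by
  have h1 : Real.sqrt 5 < 3 := by
    rw [Real.sqrt_lt' (by norm_num)]
    norm_num
  have h2 : (9 : ℝ) / 5 < Real.sqrt 5 := by
    rw [Real.lt_sqrt (by norm_num)]
    norm_num
  constructor <;> linarith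

/-! ### Composition: the stubs close the crux by name -/

/-- **COMPOSITION.** The four stubs prove the crux `PerWidthThermodynamics` (by name): witness
`U = 6`, `δ = (3 - √5)/4`; per width, `d_M = 9 c_M / π²` from the floor constant, transparency taken at
`η = c_M / 2`, `k_M` from the window, cut-off `max (L₁, L₂, L₃)`. -/
theorem PerWidthThermodynamics_of : PerWidthThermodynamics := by
  rw [perWidthThermodynamics_iff]
  refine ⟨6, by norm_num, (3 - Real.sqrt 5) / 4, witnessDoping_mem_Ioo, fun M _ hMe hM2 => ?_⟩
  obtain ⟨c, hc, L₁, hfloor⟩ := stub_canonicalFluxFloor M hMe hM2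
  obtain ⟨L₂, htr⟩ := stub_transparency M hMe hM2 (c / 2) (half_pos hc)
  obtain ⟨k, L₃, hwin⟩ := stub_pairCompressibility M hMe hM2
  refine ⟨9 * c / Real.pi ^ 2, by positivity, k, max L₁ (max L₂ L₃), fun L _ hLe hML hL Λ _ _ e => ?_⟩
  have hL1 : L₁ ≤ L := (le_max_left _ _).trans hL
  have hL2 : L₂ ≤ L := ((le_max_left _ _).trans (le_max_right _ _)).trans hL
  have hL3 : L₃ ≤ L := ((le_max_right _ _).trans (le_max_right _ _)).trans hL
  exact ⟨PerWidthThermodynamics.stub_stiffness_of_floor_of_transparency L M Λ e 6 _ c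
      (hfloor L hLe hML hL1 Λ e)
      (htr L hLe hML hL2 Λ e), (hwin L hLe hML hL3 Λ e).1, (hwin L hLe hML hL3 Λ e).2⟩

end Summit.HubbardSuperconductivity.HubbardSuperconductivity.Theorems.SeamInduction

end
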